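import Literature.Probability.Percolation.CutPointAltArms
import Literature.Probability.Percolation.OneArmBoundaryArmsMixed
import HarnessLib

/-!
# Pivotal sites of the one-arm event near `∂Λ_N`: four ALTERNATING arms locally (cluster form), and the boundary product bound (proofs only)

Topic `Literature/Probability/Percolation`; family `crit-perc`, statement **crit-perc.S16**
(`Literature.Probability.Percolation.triTheta_exponent`); serves the discharge of
`Literature.Probability.Percolation.Nolin2008_thm27_oneArm` (Nolin 2008, Thm. 27, `j = 1`).
PROOFS ONLY (no definition, no named fact). Companion of `CutPointAltArms.lean` for the boundary
layer: the painted-exterior device of `OneArmBoundaryArms.lean` (W. Werner, PCMI 2009, Lecture 6,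
proof of Lemma 6.2, boundary contributions, and §5; P. Nolin, EJP 13 (2008), §4.6, §6.2) re-run
with the cut-point lemma in cluster form (`altFourArm_of_cutPoint`), so that the local four-arm
factor of a pivotal site close to `∂Λ_N` is Werner's ALTERNATING `π̂^alt` (`altFourArmProbAt`,
`AltFourArm.lean`) instead of the order-free `fourArmProbAt`:

* `paint_shift_mem_altFourArm_of_isPivotal_triOneArm` — pivotal for `{0 ↔ ∂Λ_N}`, `|v|_𝕋 ≤ N`,
  `1 ≤ D`, `2D ≤ |v|_𝕋` ⇒ the translate to `v` of `ω ∪ {|·|_𝕋 > N}` lies in `altFourArm 1 D`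
  (proof of `paint_shift_mem_armEvent_of_isPivotal_triOneArm` verbatim, last step
  `altFourArm_of_cutPoint`);
* `shift_mem_altFourArm_of_isPivotal_triOneArm'` — for `1 ≤ d`, `2d ≤ |v|_𝕋`, `|v|_𝕋 + d ≤ N`:
  `ω - v ∈ altFourArm 1 d`;
* `boundary_pivotal_three_le_mixed_alt` — the three-factor bound of
  `boundary_pivotal_three_le_mixed` (`OneArmBoundaryArmsMixed.lean`) with `π̂^alt_t(r₀, d')`:
  `P_t(v pivotal) ≤ P_t(0 ↔ ∂Λ_{m₀}) · π̂^alt_t(r₀, d') · P_t(B_{T,F}(d₂ + d', D - d'))`.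

## References

* W. Werner, *Lectures on two-dimensional critical percolation*, IAS/Park City Math. Ser. 16
  (2009), Lecture 6, proof of Lemma 6.2 (boundary contributions), §4 (`π̂_p`) and §5 [WernerPCMI2009].
* P. Nolin, Near-critical percolation in two dimensions, *Electron. J. Probab.* 13 (2008), §4.1,
  §4.6, §6.2 (proof of Thm. 27, Case 1) [arXiv 0711.4948: Thm. 26] [Nolin2008].
* H. Kesten, Scaling relations for 2D-percolation, *Comm. Math. Phys.* 109 (1987), §1 (1.12),
  Lemma 8 [KestenScalingCMP1987].
* B. Bollobás, O. Riordan, *Percolation*, CUP (2006), Ch. 5, Lemma 7 [BollobasRiordan2006].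

Tree: `altFourArm_of_cutPoint`, `determinedBy_preimage_shift_altFourArm` (`CutPointAltArms.lean`),
`altFourArm`, `altFourArmProbAt`, `altFourArm_determined`, `altFourArm_mono_left`,
`determinedBy_altFourArm` (`AltFourArm.lean`), everything of `OneArmBoundaryArms.lean`
(`exists_radial_dir`, `pathIn_ray`, `exists_rot_halfPlane_superset`, `real_domArmEvent_rotPow`,
`shift_mem_domArmEvent_recenter`) and `OneArmBoundaryArmsMixed.lean` (`shift_mem_domArmEvent_mixed`),
`determinedBy_preimage_shift`, `isPivotal_triOneArm_subset_triOneArm`, `relabel_shift_shift`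
(`OneArmPivotalLayer.lean`), `determinedBy_domArmEvent` (`HalfPlaneArmEvents.lean`), `PathIn` API.
Mathlib: nothing beyond these imports.
-/

noncomputable section

open MeasureTheory Set

namespace Literature.Probability.Percolation

open LatticeModels

/-! ### The painted configuration and the cut-point lemma near the boundary, cluster form -/

section Painted

variable {N D : ℕ} {v : Site 2} {ω : SiteConfig (Site 2)}

/-- **Pivotal near the boundary ⇒ four ALTERNATING arms at any scale `D ≤ |v|/2`, in the painted
configuration** (the painted-exterior device of `OneArmBoundaryArms.lean`, proof of
`paint_shift_mem_armEvent_of_isPivotal_triOneArm` with the cluster-form cut-point lemma): if `v`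
is pivotal for `{0 ↔ ∂Λ_N}` in `ω`, `|v|_𝕋 ≤ N`, `1 ≤ D` and `2D ≤ |v|_𝕋`, then the translate to
`v` of the configuration `ω ∪ {|·|_𝕋 > N}` lies in `altFourArm 1 D`. [cite: WernerPCMI2009, Lecture 6, proof of Lemma 6.2 and §5] [cite: Nolin2008, §6.2, proof of Thm. 27, Case 1 (arXiv 0711.4948: Thm. 26)] -/
theorem paint_shift_mem_altFourArm_of_isPivotal_triOneArm (hD : 1 ≤ D)
    (hvD : 2 * (D : ℤ) ≤ triNorm v) (hvN : triNorm v ≤ N) (hpiv : IsPivotal (triOneArm N) v ω) :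
    SiteConfig.relabel (triShiftIso (-v)).toEquiv (ω ∪ {z | (N : ℤ) < triNorm z}) ∈
      altFourArm 1 D := by
  classical
  have hD0 : (0 : ℤ) ≤ D := by positivity
  set Λ : Set (Site 2) := ↑(triBall N) with hΛ
  have hΛmem : ∀ {z : Site 2}, z ∈ Λ ↔ triNorm z ≤ N := fun {z} => by
    rw [hΛ, Finset.mem_coe, mem_triBall_iff]
  set Ext : Set (Site 2) := {z | (N : ℤ) < triNorm z} with hExt
  have hExtmem : ∀ {z : Site 2}, z ∈ Ext ↔ (N : ℤ) < triNorm z := fun {z} => Iff.rfl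
  set ωp : SiteConfig (Site 2) := ω ∪ Ext with hωp
  rw [isPivotal_iff_insert_mem_and_notMem (isUpperSet_triOneArm N)] at hpiv
  obtain ⟨⟨y, hy, hconn⟩, hnot⟩ := hpiv
  rw [mem_triSphere_iff] at hy
  have hγ : PathIn triGraph (Λ ∩ insert v ω) 0 y := PathIn.of_mem_siteConnIn hconn
  set A : Set (Site 2) := (Λ ∩ insert v ω) \ {v} with hA
  set A' : Set (Site 2) := Λ ∩ (ω \ {v}) with hA'
  have hAsub : A ⊆ A' := inter_insert_diff_subset Λ v ω
  set Bset : Set (Site 2) := A' ∪ Ext with hBset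
  have hA'B : A' ⊆ Bset := subset_union_left
  have hvΛ : v ∈ Λ := hΛmem.2 hvN
  have hvExt : v ∉ Ext := fun h => by rw [hExtmem] at h; omega
  have hBωp : Bset ⊆ ωp \ {v} := by
    rintro z (⟨-, hzω, hzv⟩ | hz)
    · exact ⟨Or.inl hzω, hzv⟩
    · exact ⟨Or.inr hz, fun h => hvExt (by rw [mem_singleton_iff] at h; rwa [h] at hz)⟩
  have hv0 : (v : Site 2) ≠ 0 := by
    intro h; rw [h] at hvD; simp [triNorm] at hvD; omega
  -- the open path passes through `v`: the inward half-path `α`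
  rcases hγ.split_at v with havoid | ⟨hP, hS⟩
  · exact (hnot ⟨y, mem_triSphere_iff.2 hy, (havoid.mono hAsub).mem_siteConnIn⟩).elim
  obtain ⟨a₁, ha₁v, hpre⟩ := hP.resolve_left hv0.symm
  -- the outward half-path `β`, prolonged through the paint along a radial ray from `y`
  obtain ⟨u, hu0, -, hun⟩ := exists_radial_dir y
  set J : ℕ := 2 * N + D with hJ
  set e : Site 2 := y + (J : ℤ) • u with he
  have heExt : ∀ i : ℕ, 1 ≤ i → y + (i : ℤ) • u ∈ Ext := fun i hi => by
    rw [hExtmem, hun i, hy]; omega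
  have hadj_shift : ∀ (z : Site 2), triGraph.Adj z (z + u) := fun z => by
    have := (triGraph_adj_shift_iff z 0 u).2 hu0
    simpa [Site.shift_apply, add_comm] using this
  have hout : ∃ b₁, triGraph.Adj b₁ v ∧ PathIn triGraph Bset b₁ e := by
    by_cases hyv : y = v
    · -- the path ends at `v ∈ ∂Λ_N`: go straight out from `v`
      refine ⟨y + ((1 : ℕ) : ℤ) • u, ?_, ?_⟩
      · have h1u : y + ((1 : ℕ) : ℤ) • u = y + u := by simp
        rw [h1u, ← hyv]; exact (hadj_shift y).symm
      · have hJ1 : 1 ≤ J := by omega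
        have hp := pathIn_ray (S := Bset) (z := y + ((1 : ℕ) : ℤ) • u) hu0 (J - 1) fun i hi => by
          rw [add_assoc, ← add_smul]
          have : y + (((1 : ℕ) : ℤ) + (i : ℤ)) • u = y + (((1 + i : ℕ)) : ℤ) • u := by push_cast; rfl
          rw [this]
          exact Or.inr (heExt (1 + i) (by omega))
        have heq : y + ((1 : ℕ) : ℤ) • u + ((J - 1 : ℕ) : ℤ) • u = e := by
          rw [he, add_assoc, ← add_smul]
          congr 2
          push_cast [Nat.cast_sub hJ1]; ring
        rwa [heq] at hp
    · obtain ⟨b₁, hb₁v, hsuf⟩ := hS.resolve_left hyv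
      refine ⟨b₁, hb₁v, (hsuf.symm.mono (hAsub.trans hA'B)).trans ?_⟩
      have hyA' : y ∈ A' := hAsub ⟨hγ.right_mem, hyv⟩
      refine pathIn_ray (S := Bset) (z := y) hu0 J fun i hi => ?_
      rcases Nat.eq_zero_or_pos i with rfl | hi0
      · simpa using hA'B hyA'
      · exact Or.inr (heExt i hi0)
  obtain ⟨b₁, hb₁v, hβB⟩ := hout
  -- translate by `-v`
  set φ := triShiftIso (-v) with hφ
  have hφapp : ∀ w, φ w = w - v := fun w => by simp [hφ, sub_eq_add_neg]
  have himage : ∀ (T : Set (Site 2)) (w : Site 2), w ∈ φ '' T ↔ w + v ∈ T := by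
    intro T w
    constructor
    · rintro ⟨w', hw', rfl⟩; rw [hφapp]; simpa using hw'
    · intro hw; exact ⟨w + v, hw, by rw [hφapp]; simp⟩
  set ξ : SiteConfig (Site 2) := SiteConfig.relabel φ.toEquiv ωp with hξ
  have hmemξ : ∀ w, w ∈ ξ ↔ w + v ∈ ωp := by
    intro w
    rw [hξ, SiteConfig.mem_relabel_iff]
    have : φ.toEquiv.symm w = w + v := by
      apply φ.toEquiv.injective
      rw [Equiv.apply_symm_apply]
      show w = φ (w + v)
      rw [hφapp]; simp
    rw [this]
  have hadj : ∀ {w : Site 2}, triGraph.Adj w v → triGraph.Adj (φ w) 0 := by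
    intro w hw
    have := φ.map_adj_iff.2 hw
    rwa [show φ v = 0 by rw [hφapp, sub_self]] at this
  set U : Set (Site 2) := φ '' Bset with hU
  have hAU : φ '' A ⊆ U := image_mono (hAsub.trans hA'B)
  have hUξ : ∀ w ∈ U, w ∈ ξ ∧ w ≠ 0 := by
    intro w hw
    rw [hU, himage] at hw
    obtain ⟨hw1, hw2⟩ := hBωp hw
    refine ⟨(hmemξ w).2 hw1, fun h => hw2 ?_⟩
    rw [mem_singleton_iff, h, zero_add]
  have hα₀ : PathIn triGraph U (φ a₁) (φ 0) := (pathIn_map_iso φ hpre.symm).mono hAU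
  have hβ₀ : PathIn triGraph U (φ b₁) (φ e) := pathIn_map_iso φ hβB
  -- the interior of the box; the far endpoints lie outside it
  set R : Set (Site 2) := {z | |z 0| < D ∧ |z 1| < D} with hR
  have hRmem : ∀ {z : Site 2}, z ∈ R ↔ |z 0| < D ∧ |z 1| < D := fun {z} => Iff.rfl
  have hφ0far : φ 0 ∉ R := by
    intro h0
    obtain ⟨h0a, h0b⟩ := h0
    rw [hφapp, zero_sub, Pi.neg_apply, abs_neg] at h0a
    rw [hφapp, zero_sub, Pi.neg_apply, abs_neg] at h0b
    have := triNorm_le_abs_add_abs v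
    omega
  have hφefar : φ e ∉ R := by
    intro h0
    obtain ⟨h0a, h0b⟩ := h0
    rw [hφapp] at h0a h0b
    have hJ' : triNorm e = N + J := by rw [he, hun J, hy]
    have hkey := triNorm_le_abs_add_abs e
    obtain ⟨hv0', hv1', -⟩ := abs_le_triNorm v
    have he0 : |e 0| ≤ |(e - v) 0| + |v 0| := by
      have : e 0 = (e - v) 0 + v 0 := by simp
      rw [this]; exact (abs_add_le _ _).trans (by simp)
    have he1 : |e 1| ≤ |(e - v) 1| + |v 1| := by
      have : e 1 = (e - v) 1 + v 1 := by simp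
      rw [this]; exact (abs_add_le _ _).trans (by simp)
    omega
  -- stopping a half-path on the boundary of the box, with a tight support
  have stop : ∀ {u₁ e' : Site 2}, triGraph.Adj u₁ 0 → e' ∉ R → PathIn triGraph U u₁ e' →
      ∃ (S : Set (Site 2)) (c : Site 2), S ⊆ triSqBox D ∩ U ∧ PathIn triGraph S u₁ c ∧
        (|c 0| = D ∨ |c 1| = D) ∧ ∀ z ∈ S, PathIn triGraph U u₁ z := by
    intro u₁ e' hu₁ he' hp
    have hu₁1 : triNorm u₁ = 1 := by
      have := triNorm_sub_eq_one_of_adj hu₁; rwa [sub_zero] at this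
    obtain ⟨hu0', hu1', -⟩ := abs_le_triNorm u₁
    by_cases huR : u₁ ∈ R
    · obtain ⟨p, q, hpR, hqR, hqA, hpq, hpath⟩ := hp.exit huR he'
      have hpath' : PathIn triGraph (insert q (R ∩ U)) u₁ q :=
        (hpath.mono fun z hz => mem_insert_of_mem _ hz).tail hpq (mem_insert q _)
      obtain ⟨S, hS, hSp, hall⟩ := hpath'.exists_support
      have hq : q ∈ triSqBox D ∧ (|q 0| = D ∨ |q 1| = D) := by
        rw [hRmem, abs_lt, abs_lt] at hpR
        rw [hRmem, not_and_or, not_lt, not_lt, le_abs, le_abs] at hqR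
        rw [triGraph_adj_iff_coord] at hpq
        rw [mem_triSqBox, abs_le, abs_le, abs_eq hD0, abs_eq hD0]
        omega
      have hSsub : S ⊆ triSqBox D ∩ U := by
        intro z hz
        rcases hS hz with h | ⟨hzR, hzA⟩
        · rw [h]; exact ⟨hq.1, hqA⟩
        · rw [hRmem, abs_lt, abs_lt] at hzR
          exact ⟨by rw [mem_triSqBox, abs_le, abs_le]; omega, hzA⟩
      exact ⟨S, q, hSsub, hSp, hq.2, fun z hz => (hall z hz).mono fun w hw => (hSsub hw).2⟩
    · refine ⟨{u₁}, u₁, ?_, PathIn.refl (mem_singleton u₁), ?_, ?_⟩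
      · intro z hz
        rw [mem_singleton_iff] at hz
        rw [hz]
        exact ⟨by rw [mem_triSqBox]; constructor <;> omega, hp.left_mem⟩
      · rw [hRmem, not_and_or, not_lt, not_lt] at huR
        rcases huR with h | h
        · left; omega
        · right; omega
      · intro z hz
        rw [mem_singleton_iff] at hz
        rw [hz]
        exact PathIn.refl hp.left_mem
  obtain ⟨Sα, a, hSα, hα, had, hallα⟩ := stop (hadj ha₁v) hφ0far hα₀
  obtain ⟨Sβ, b, hSβ, hβ, hbd, hallβ⟩ := stop (hadj hb₁v) hφefar hβ₀
  have hSα' : Sα ⊆ (triSqBox D \ {0}) ∩ ξ := fun z hz =>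
    ⟨⟨(hSα hz).1, (hUξ z (hSα hz).2).2⟩, (hUξ z (hSα hz).2).1⟩
  have hSβ' : Sβ ⊆ (triSqBox D \ {0}) ∩ ξ := fun z hz =>
    ⟨⟨(hSβ hz).1, (hUξ z (hSβ hz).2).2⟩, (hUξ z (hSβ hz).2).1⟩
  refine altFourArm_of_cutPoint hD hSα' hSβ' (hadj ha₁v) (hadj hb₁v) hα hβ had hbd ?_
  -- the cut-point hypothesis: an open junction, read in `ω`, would join `0` to `∂Λ_N`
  intro z hz z' hz' hp
  have W : PathIn triGraph (U ∪ (triSqBox D \ {0}) ∩ ξ) (φ 0) (φ e) :=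
    (((hα₀.symm.trans (hallα z hz)).mono subset_union_left).trans
      (hp.mono subset_union_right)).trans (((hallβ z' hz').symm.trans hβ₀).mono subset_union_left)
  have hback := pathIn_map_iso (triShiftIso v) W
  have e1 : ∀ w, triShiftIso v (φ w) = w := fun w => by rw [triShiftIso_apply, hφapp]; abel
  rw [e1, e1] at hback
  have hset : (triShiftIso v) '' (U ∪ (triSqBox D \ {0}) ∩ ξ) ⊆ ωp \ {v} := by
    rintro _ ⟨w, hw, rfl⟩
    rw [triShiftIso_apply]
    rcases hw with hw | ⟨⟨-, hw0⟩, hwξ⟩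
    · rw [hU, himage] at hw; exact hBωp hw
    · refine ⟨(hmemξ w).1 hwξ, fun h => hw0 ?_⟩
      rw [mem_singleton_iff] at h ⊢
      have : w + v = 0 + v := by rw [zero_add]; exact h
      exact add_right_cancel this
  have W' : PathIn triGraph (ωp \ {v}) 0 e := hback.mono hset
  have h0Λ : (0 : Site 2) ∈ Λ := hΛmem.2 (by simp [triNorm])
  have heΛ : e ∉ Λ := by
    intro h; rw [hΛmem] at h
    have := heExt J (by omega)
    rw [hExtmem] at this
    exact absurd h (not_le.2 (by rw [he]; exact this))
  obtain ⟨p, q, hpΛ, hqΛ, -, hpq, hpath⟩ := W'.exit h0Λ heΛ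
  rw [hΛmem] at hpΛ
  rw [hΛmem, not_le] at hqΛ
  have hpN : triNorm p = N := le_antisymm hpΛ (by
    have := triNorm_le_triNorm_add_one_of_adj hpq; omega)
  refine hnot ⟨p, mem_triSphere_iff.2 hpN, (hpath.mono ?_).mem_siteConnIn⟩
  rintro w ⟨hwΛ, hwω, hwv⟩
  refine ⟨hwΛ, ?_, hwv⟩
  rcases hwω with h | h
  · exact h
  · rw [hExtmem] at h; rw [hΛmem] at hwΛ; omega

/-- **Genuine local ALTERNATING four arms up to the distance to the boundary** (as
`shift_mem_armEvent_of_isPivotal_triOneArm'`): if `v` is pivotal for `{0 ↔ ∂Λ_N}`, `1 ≤ d`,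
`2d ≤ |v|_𝕋` and `|v|_𝕋 + d ≤ N` (so that `Λ_d(v) ⊆ Λ_N`, where the painted configuration agrees
with `ω`), then `ω - v ∈ altFourArm 1 d`. [cite: Nolin2008, §6.2, proof of Thm. 27, Case 1 (arXiv 0711.4948: Thm. 26)] -/
theorem shift_mem_altFourArm_of_isPivotal_triOneArm' {d : ℕ} (hd : 1 ≤ d)
    (hvd : 2 * (d : ℤ) ≤ triNorm v) (hdN : triNorm v + d ≤ N) (hpiv : IsPivotal (triOneArm N) v ω) :
    SiteConfig.relabel (triShiftIso (-v)).toEquiv ω ∈ altFourArm 1 d := by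
  have hvN : triNorm v ≤ N := by have := (Nat.cast_nonneg d : (0 : ℤ) ≤ d); omega
  have h := paint_shift_mem_altFourArm_of_isPivotal_triOneArm hd hvd hvN hpiv
  set φ := triShiftIso (-v) with hφ
  have hsymm : ∀ z : Site 2, φ.toEquiv.symm z = z + v := by
    intro z
    apply φ.toEquiv.injective
    rw [Equiv.apply_symm_apply]
    show z = φ (z + v)
    simp [hφ]
  refine (altFourArm_determined hd _ _ fun z hz => ?_).1 h
  rw [mem_triAnnulus] at hz
  rw [SiteConfig.mem_relabel_iff, SiteConfig.mem_relabel_iff, hsymm]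
  have hzv : triNorm (z + v) ≤ N := by have := triNorm_add_le z v; omega
  simp only [Set.mem_union, Set.mem_setOf_eq, or_iff_left_iff_imp]
  intro h'; omega


end Painted

/-! ### The product bound with the mixed pair, alternating local factor -/

section Boundary

variable {N D k d' d₂ m₀ r₀ : ℕ} {v : Site 2}

/-- **Three factors for a pivotal site near the boundary, mixed pair, ALTERNATING local factor**
(as `boundary_pivotal_three_le_mixed`, `OneArmBoundaryArmsMixed.lean`, with `altFourArm` /
`altFourArmProbAt`; Werner 2009, Lecture 6, proof of Lemma 6.2, boundary contributions, adapted to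
the one-arm event, §5; Nolin 2008, §4.6).
For `|v|_𝕋 = k`, `k + d' = N`, `1 ≤ r₀ ≤ d'`, `2d' ≤ k`, `1 ≤ D`, `2D ≤ k`, `m₀ + D + 1 ≤ k`,
`d' + 1 ≤ d₂`, `d₂ + 2d' + 1 ≤ D`:
`P_t(v pivotal for 0 ↔ ∂Λ_N) ≤ P_t(0 ↔ ∂Λ_{m₀}) · π̂^alt_t(r₀, d') · P_t(B_{T,F}(d₂ + d', D - d'))`,
`B_{T,F}(m, n) = domArmEvent ![T,F] m n upperHalfPlane` (the tree's `boundary_pivotal_three_le` with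
the mixed pair `shift_mem_domArmEvent_mixed` in place of the two closed arms; the three events are
determined by the disjoint site sets `Λ_{m₀}`, `v + (Λ_{d'} \ Λ_{r₀-1})`,
`(v + t) + (Λ_{D-d'} \ Λ_{d₂+d'-1})`, and `P_t` is invariant under translations and rotations). [cite: WernerPCMI2009, Lecture 6, proof of Lemma 6.2 (boundary contributions) and §5] [cite: Nolin2008, §4.6] -/
theorem boundary_pivotal_three_le_mixed_alt (t : unitInterval) (hk : triNorm v = k) (hkN : k + d' = N)
    (hr₀ : 1 ≤ r₀) (hr₀d : r₀ ≤ d') (h2d : 2 * d' ≤ k) (hD : 1 ≤ D) (h2D : 2 * D ≤ k)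
    (hm₀ : m₀ + D + 1 ≤ k) (hd₂ : d' + 1 ≤ d₂) (hrec : d₂ + 2 * d' + 1 ≤ D) :
    (triSitePercolation t).real {ω | IsPivotal (triOneArm N) v ω} ≤
      (triSitePercolation t).real (triOneArm m₀) * (altFourArmProbAt t r₀ d' *
        (triSitePercolation t).real (domArmEvent ![true, false] (d₂ + d') (D - d') upperHalfPlane)) := by
  classical
  obtain ⟨j, -, tt, htt, hdom⟩ := exists_rot_halfPlane_superset (N := N) hk hkN
  set G : Set (Site 2) := (triRotIsoPow j) '' upperHalfPlane with hG
  set A : Set (SiteConfig (Site 2)) := triOneArm m₀ with hA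
  set B : Set (SiteConfig (Site 2)) :=
    SiteConfig.relabel (triShiftIso (-v)).toEquiv ⁻¹' altFourArm r₀ d' with hB
  set C : Set (SiteConfig (Site 2)) :=
    SiteConfig.relabel (triShiftIso (-(v + tt))).toEquiv ⁻¹'
      domArmEvent ![true, false] (d₂ + d') (D - d') G with hC
  -- the inclusion
  have hincl : {ω : SiteConfig (Site 2) | IsPivotal (triOneArm N) v ω} ⊆ A ∩ (B ∩ C) := by
    intro ω hω
    have hω' : IsPivotal (triOneArm N) v ω := hω
    refine ⟨isPivotal_triOneArm_subset_triOneArm hk (by omega) hω, ?_, ?_⟩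
    · exact altFourArm_mono_left hr₀ hr₀d
        (shift_mem_altFourArm_of_isPivotal_triOneArm' (N := N) (hr₀.trans hr₀d)
          (by rw [hk]; exact_mod_cast h2d) (by rw [hk]; exact_mod_cast hkN.le) hω')
    · have h2 := shift_mem_domArmEvent_mixed (N := N) hD (by rw [hk]; exact_mod_cast h2D)
        (by rw [hk]; exact_mod_cast (show k ≤ N by omega)) hω' (d₂ := d₂) (by omega) (by omega)
      have h3 := shift_mem_domArmEvent_recenter (κ := ![true, false]) (G := G) htt hrec hdom h2
      rw [relabel_shift_shift] at h3
      exact h3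
  -- determining sets
  set F : Finset (Site 2) := triBall m₀ with hF
  set G₁ : Finset (Site 2) := (triAnnulus r₀ d').image fun u => u + v with hG₁
  set G₂ : Finset (Site 2) := (triAnnulus (d₂ + d') (D - d')).image fun u => u + (v + tt) with hG₂
  have hAF : DeterminedBy A ↑F := determinedBy_triOneArm m₀
  have hBG : DeterminedBy B ↑G₁ := determinedBy_preimage_shift (determinedBy_altFourArm hr₀d) v
  have hCG : DeterminedBy C ↑G₂ :=
    determinedBy_preimage_shift (determinedBy_domArmEvent _ (by omega) G) (v + tt)
  have hG₁mem : ∀ z ∈ G₁, (k : ℤ) - d' ≤ triNorm z ∧ triNorm (z - v) ≤ d' := by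
    intro z hz
    rw [hG₁, Finset.mem_image] at hz
    obtain ⟨u, hu, rfl⟩ := hz
    rw [mem_triAnnulus] at hu
    have h1 := triNorm_add_le (u + v) (-u)
    rw [add_neg_cancel_comm, triNorm_neg] at h1
    refine ⟨by rw [← hk]; omega, by rw [add_sub_cancel_right]; exact hu.2⟩
  have hG₂mem : ∀ z ∈ G₂, (k : ℤ) - D ≤ triNorm z ∧ (d₂ : ℤ) ≤ triNorm (z - v) := by
    intro z hz
    rw [hG₂, Finset.mem_image] at hz
    obtain ⟨u, hu, rfl⟩ := hz
    rw [mem_triAnnulus] at hu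
    push_cast [Nat.cast_sub (show d' ≤ D by omega)] at hu
    have h1 := triNorm_add_le (u + (v + tt)) (-(u + tt))
    rw [show u + (v + tt) + -(u + tt) = v by abel, triNorm_neg] at h1
    have h2 := triNorm_add_le u tt
    have h3 := triNorm_add_le (u + tt) (-tt)
    rw [add_neg_cancel_right, triNorm_neg] at h3
    rw [htt] at h2 h3
    refine ⟨by rw [← hk]; omega, ?_⟩
    rw [show u + (v + tt) - v = u + tt by abel]
    omega
  have hFG₁ : Disjoint F G₁ := by
    rw [Finset.disjoint_left]
    intro z hzF hz
    rw [hF, mem_triBall_iff] at hzF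
    have := (hG₁mem z hz).1; omega
  have hFG₂ : Disjoint F G₂ := by
    rw [Finset.disjoint_left]
    intro z hzF hz
    rw [hF, mem_triBall_iff] at hzF
    have := (hG₂mem z hz).1; omega
  have hG₁G₂ : Disjoint G₁ G₂ := by
    rw [Finset.disjoint_left]
    intro z hz1 hz2
    have := (hG₁mem z hz1).2; have := (hG₂mem z hz2).2; omega
  have hBC : DeterminedBy (B ∩ C) ↑(G₁ ∪ G₂) :=
    (hBG.mono (by rw [Finset.coe_union]; exact Set.subset_union_left)).inter
      (hCG.mono (by rw [Finset.coe_union]; exact Set.subset_union_right))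
  have hFGG : Disjoint F (G₁ ∪ G₂) := Finset.disjoint_union_right.2 ⟨hFG₁, hFG₂⟩
  -- independence, translation and rotation invariance
  have h1 : (triSitePercolation t).real (A ∩ (B ∩ C)) =
      (triSitePercolation t).real A * (triSitePercolation t).real (B ∩ C) :=
    sitePercolation_real_inter_of_disjoint t hAF hBC hFGG
  have h2 : (triSitePercolation t).real (B ∩ C) =
      (triSitePercolation t).real B * (triSitePercolation t).real C :=
    sitePercolation_real_inter_of_disjoint t hBG hCG hG₁G₂
  have h3 : (triSitePercolation t).real B = altFourArmProbAt t r₀ d' := by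
    rw [altFourArmProbAt, hB, triSitePercolation]
    exact sitePercolation_real_preimage_relabel _ t _
  have h4 : (triSitePercolation t).real C =
      (triSitePercolation t).real (domArmEvent ![true, false] (d₂ + d') (D - d') upperHalfPlane) := by
    rw [hC, triSitePercolation, sitePercolation_real_preimage_relabel, hG]
    exact real_domArmEvent_rotPow t _ _ _ j
  calc (triSitePercolation t).real {ω | IsPivotal (triOneArm N) v ω}
      ≤ (triSitePercolation t).real (A ∩ (B ∩ C)) := measureReal_mono hincl
    _ = (triSitePercolation t).real A * (altFourArmProbAt t r₀ d' *
          (triSitePercolation t).real (domArmEvent ![true, false] (d₂ + d') (D - d') upperHalfPlane)) := by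
        rw [h1, h2, h3, h4]


end Boundary

end Literature.Probability.Percolation
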